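import Literature.RepresentationTheory.FiniteGroups.MonomialCharacters
import Mathlib.GroupTheory.Solvable
import HarnessLib

/-!
# Brauer's induction theorem with SOLVABLE inducing subgroups (helper for
# `PotentialCompanionDescent.BrauerTaylorDescent`, item stmt-Langlands-33718)

Barnet-Lamb–Gee–Geraghty–Taylor (*Potential automorphy and change of weight*, Ann. of Math. 179
(2014), proof of Thm. 5.5.1 = arXiv:1010.2561 Thm. 5.4.1) start the descent of compatible systems
along a Galois extension `L/K` from "Brauer's theorem: `1 = ∑ᵢ nᵢ Ind_{Hᵢ}^{Gal(L/K)} θᵢ` with `Hᵢ`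
SOLVABLE (indeed elementary, hence nilpotent) and `θᵢ` characters of degree one".  The tree's
`Literature.RepresentationTheory.FiniteGroups.brauer_induction_holds` (Serre §10.5 Thm. 20) records
the monomial form but forgets that the inducing subgroups may be taken inside elementary subgroups.
This file re-runs its last step keeping that information:

* `exists_solvable_monomial_indClassFun` — transitivity of induction keeping the inducing
  subgroups solvable;
* `exists_brauer_solvable` — every character of a finite group is a `ℤ`-combination of characters
  induced from degree-one characters of SOLVABLE subgroups;
* `exists_brauer_solvable_one` — the case of the trivial character, pointwise:
  `∑ᵢ nᵢ · Ind_{Hᵢ}^G θᵢ (s) = 1` for every `s`.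

References: J.-P. Serre, *Linear Representations of Finite Groups*, GTM 42 (1977), §10.5 Thms. 19–20
[SerreLinearRepresentations1977]; BLGGT 2014, proof of Thm. 5.5.1 [BarnetlambEtAl2014].
-/

-- `Summit.Langlands.Langlands.…` (summit = sub-problem name) trips `dupNamespace`.
set_option linter.dupNamespace false

noncomputable section

open scoped BigOperators
open Literature.RepresentationTheory.FiniteGroups

namespace Summit.Langlands.Langlands.Theorems.BrauerTaylorDescent

variable {G : Type} [Group G]

/-- Transitivity step with solvability recorded: if `θ = ∑ᵢ Ind_{Hᵢ}^K μᵢ` on `K ≤ G` with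
`Hᵢ ≤ K` solvable and `μᵢ : Hᵢ →* ℂˣ`, then `Ind_K^G θ = ∑ᵢ Ind_{Hᵢ'}^G μᵢ'` with `Hᵢ' ≤ G`
solvable (`Hᵢ' = Hᵢ` viewed in `G` through `K.subtype`, an isomorphic copy) and
`μᵢ' : Hᵢ' →* ℂˣ` (`indClassFun_indClassFun_map`). [folklore] -/
theorem exists_solvable_monomial_indClassFun [Fintype G] (K : Subgroup G) [Fintype K] {θ : K → ℂ}
    {ι : Type} [Fintype ι] (H : ι → Subgroup K) (μ : ∀ i, H i →* ℂˣ)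
    (hsolv : ∀ i, IsSolvable (H i)) (hθ : θ = ∑ i, indClassFun (H i) (fun h => (μ i h : ℂ))) :
    ∃ (H' : ι → Subgroup G) (μ' : ∀ i, H' i →* ℂˣ), (∀ i, IsSolvable (H' i)) ∧
      indClassFun K θ = ∑ i, indClassFun (H' i) (fun h => (μ' i h : ℂ)) := by
  subst hθ
  refine ⟨fun i => (H i).map K.subtype, fun i => (μ i).comp
    (Subgroup.equivMapOfInjective (H i) K.subtype K.subtype_injective).symm.toMonoidHom,
    fun i => ?_, ?_⟩
  · haveI := hsolv i
    exact solvable_of_solvable_injective (G := (H i).map K.subtype) (G' := H i)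
      (f := (Subgroup.equivMapOfInjective (H i) K.subtype K.subtype_injective).symm.toMonoidHom)
      (Subgroup.equivMapOfInjective (H i) K.subtype K.subtype_injective).symm.injective
  · rw [indClassFun_sum]
    refine Finset.sum_congr rfl fun i _ => ?_
    exact indClassFun_indClassFun_map K (H i) _

/-- **Brauer's induction theorem with solvable inducing subgroups** (Serre §10.5 Thms. 19–20;
the form quoted by BLGGT 2014, proof of Thm. 5.5.1): every character `χ` of a finite group `G`
is `χ = ∑ᵢ nᵢ · Ind_{Hᵢ}^G θᵢ` with `nᵢ ∈ ℤ`, `Hᵢ ≤ G` SOLVABLE and `θᵢ : Hᵢ →* ℂˣ`.  Proof: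
Brauer's elementary form (`brauer_induction_elementary_holds`), Serre's Thm. 16 on the nilpotent
elementary subgroups (`IsCharacter.isMonomialSum_of_isNilpotent`: there the inducing subgroups are
subgroups of a nilpotent group, hence solvable) and transitivity of induction.
[cite: SerreLinearRepresentations1977, §10.5 Thm. 20] [cite: BarnetlambEtAl2014, proof of Thm. 5.5.1] -/
theorem exists_brauer_solvable [Fintype G] (χ : G → ℂ) (hχ : IsCharacter G χ) :
    ∃ (ι : Type) (_ : Fintype ι) (H : ι → Subgroup G) (θ : ∀ i, H i →* ℂˣ) (n : ι → ℤ),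
      (∀ i, IsSolvable (H i)) ∧
        χ = ∑ i, (n i : ℂ) • indClassFun (H i) (fun h => (θ i h : ℂ)) := by
  classical
  obtain ⟨ι, hι, H, φ, n, hH, hφ, heq⟩ := brauer_induction_elementary_holds G χ hχ
  have hind : ∀ i, ∃ (κ : Type) (_ : Fintype κ) (L : κ → Subgroup G) (θ : ∀ a, L a →* ℂˣ),
      (∀ a, IsSolvable (L a)) ∧
        indClassFun (H i) (φ i) = ∑ a, indClassFun (L a) (fun h => (θ a h : ℂ)) := by
    intro i
    obtain ⟨p, hp, hel⟩ := hH i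
    haveI : Group.IsNilpotent (H i) := hel.isNilpotent hp
    obtain ⟨κ, hκ, L₀, μ, hμ⟩ := IsCharacter.isMonomialSum_of_isNilpotent (hφ i)
    -- subgroups of the nilpotent (hence solvable) `H i` are solvable
    obtain ⟨L, θ, hL, hLθ⟩ := exists_solvable_monomial_indClassFun (H i) L₀ μ
      (fun a => inferInstance) hμ
    exact ⟨κ, hκ, L, θ, hL, hLθ⟩
  choose κ hκ L θ hLsolv hLθ using hind
  letI : ∀ i, Fintype (κ i) := hκ
  refine ⟨Σ i, κ i, inferInstance, fun x => L x.1 x.2, fun x => θ x.1 x.2, fun x => n x.1,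
    fun x => hLsolv x.1 x.2, ?_⟩
  rw [heq, Fintype.sum_sigma]
  simp only [hLθ, Finset.smul_sum]

/-- **Brauer's theorem for the trivial character, solvable form, pointwise**: for every finite
group `G` there are solvable subgroups `Hᵢ`, degree-one characters `θᵢ : Hᵢ →* ℂˣ` and integers
`nᵢ` with `∑ᵢ nᵢ · Ind_{Hᵢ}^G θᵢ (s) = 1` for every `s ∈ G` — the input of the Brauer–Taylor
descent (BLGGT 2014, proof of Thm. 5.5.1: "`1 = ∑ nᵢ Ind θᵢ`").
[cite: BarnetlambEtAl2014, proof of Thm. 5.5.1] [cite: SerreLinearRepresentations1977, §10.5 Thm. 20] -/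
theorem exists_brauer_solvable_one (G : Type) [Group G] [Fintype G] :
    ∃ (ι : Type) (_ : Fintype ι) (H : ι → Subgroup G) (θ : ∀ i, H i →* ℂˣ) (n : ι → ℤ),
      (∀ i, IsSolvable (H i)) ∧
        ∀ s : G, ∑ i, (n i : ℂ) * indClassFun (H i) (fun h => (θ i h : ℂ)) s = 1 := by
  obtain ⟨ι, hι, H, θ, n, hsolv, heq⟩ := exists_brauer_solvable (G := G) 1 isCharacter_one
  refine ⟨ι, hι, H, θ, n, hsolv, fun s => ?_⟩
  have := congrFun heq s
  simp only [Finset.sum_apply, Pi.smul_apply, smul_eq_mul, Pi.one_apply] at this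
  exact this.symm

end Summit.Langlands.Langlands.Theorems.BrauerTaylorDescent

end
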